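/-
Origin: expansion seat `prover-pub-hodgecm-mc-sinst-1-g4-0`, handover #1217 2026-08-20T08:48Z md5 d753083a456c (252 l., 8 theorems) NEW additive drop-alone leaf after installed #1214; (J-μ) slots 2/3 read-off socket: §0 toAdeleGL_eq_adelic_toAdeleGL, cmPlaneTorusIdeles_inf_eq_archToAdelic' (primed plane), cmConjPlaneTorusIdeles_inf_eq_archToAdelic ((ARCH) PROVED: conj torus at arch ideles = archToAdelic (HypCensus.archConjDiag g₀ dW dW' hg₀ u)), cmPairRep_conjPlaneTorus_eq_adelicTensorEnd (step (6): = ω_∞(1, archConjDiag u) ⊗ 1); §1 cmPairRep_conjPlaneTorus_conjLineTensorFin_of_arch_eigen ((STRIP) + arch eigen-identity ⇒ #1213's h'); §2 rep_conj_apply_eq_smul, cmArchWeilRep_archConjDiag_eigen_of_transport ((7) archConjDiag u = k·archDiag(ρ u)·k⁻¹ + (VT) Y = a • ω_∞(1,k) Φ_X + plane eigen-character χ ⇒ ω_∞(1, archConjDiag u) Y = χ(ρ u) • Y); §3 slotTypeVec_sub_eq_of_conj_transport (slotTypeVec 2 − 0 = n₂ − m₀ ∧ slotTypeVec 3 − 0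 = n₃ − m₀ from (STRIP)+(7)+(VT)+χ-tables); NAME LIST: HodgeCM.Model.ArchSideTerm.cmConjPlaneTorusIdeles_inf_eq_archToAdelic · HodgeCM.Model.ArchSideTerm.cmPairRep_conjPlaneTorus_eq_adelicTensorEnd · HodgeCM.Model.ArchSideTerm.cmPairRep_conjPlaneTorus_conjLineTensorFin_of_arch_eigen · HodgeCM.Model.ArchSideTerm.cmArchWeilRep_archConjDiag_eigen_of_transport · HodgeCM.Model.ArchSideTerm.slotTypeVec_sub_eq_of_conj_transport (`HOME/mc/pub-hodgecm-mc-sinst-1-g4/stage/HodgeCM/Model/ArchLineSlotTypeConjArch.lean`, md5 d753083a456c, 252 lines);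
landed by the second packager p2 gen 5 (p2-g5) in gate run 46 as `HodgeCM/Model/ArchLineSlotTypeConjArch.lean` (verbatim).
-/
/-
Origin: speedrun cell pub-hodgecm, MODEL-CONSTRUCTION sub-cell, lineage mc-sinst-1 (S-instance constructor, BINDER-OWNERS row 5 `S` / row 6 `μ`: (J-μ) slots 2/3),
seat prover-pub-hodgecm-mc-sinst-1-g4-0 (gen 4), 2026-08-20.  Target in PKG: `HodgeCM/Model/ArchLineSlotTypeConjArch.lean`
(NEW additive drop-alone leaf; imports the installed RUN-43 #1214 `Model/ArchLineSlotTypeArch` only).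
KERNEL only: 0 records / `def … : Prop` / cites, 0 proof holes; intended closure {propext, Classical.choice, Quot.sound}.
-/
import Summits.HodgeConjecture.HodgeCM.Model.ArchLineSlotTypeArch

/-!
# (J-μ) SLOTS 2/3 IN ARCHIMEDEAN CURRENCY: the READ-OFF SOCKET for `hΔ₂` / `hΔ₃` from a vacuum-transport datum

#1213 (`slotTypeVec_sub_eq_of_conjPlaneTorus_eigen`) reads the two CROSS-PLANE slot-type differences `slotTypeVec 2 − slotTypeVec 0`,
`slotTypeVec 3 − slotTypeVec 0` (the `hΔ₂`/`hΔ₃` inputs of the S pins #1212/#1215/#1216) off two eigen-identities of the ADELIC big pair: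
`h` (plane torus `diag(t₀,t₁)_𝔸` on the plane see-saw tensor `X`) and `h'` (CONJUGATED torus `g₀·diag(t₀,t₁)·g₀⁻¹` on the conjugated tensor
`X' = φ(Φ'₀) ⊗″ φ(Φ'₁)`, `⊗″ = R_e ∘ ω(r_F h₀) ∘ R_f⁻¹ ∘ ⊠`).  #1214 + theta-3's (BF)/(BT)/(TT) settled `h` inside binder-2's archimedean engine.
This leaf is steps (6)–(8) of theta-3-g13's plan (`notes/J-MU-SLOTS23.g13.md` v2 §5) for `h'`, as ONE socket whose hypotheses are the named
remaining steps:

* §0 **(ARCH), PROVED: `cmConjPlaneTorusIdeles_inf_eq_archToAdelic`** — the conjugated torus at archimedean norm-one ideles IS binder-2's archimedean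
  element `HypCensus.archConjDiag g₀ (dW) (dW') hg₀ (t₀,t₁) = g₀,∞ · diag(t₀,t₁) · g₀,∞⁻¹ ∈ U(diag dW)(L ⊗ ℝ)` (`TorusChart.toAdeleGL_mul_toGL_mul_inv`,
  `ofInfinite_archDiagGL`; the primed-plane twin `cmPlaneTorusIdeles_inf_eq_archToAdelic'` of #1214 §2; the two `toAdeleGL`s agree); hence
  **`cmPairRep_conjPlaneTorus_eq_adelicTensorEnd`**: `cmPairRep (1, g₀·diag(t₀,t₁)·g₀⁻¹) = ω_∞(1, archConjDiag (t₀,t₁)) ⊗ 1` (carch-1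
  `cmPairRep_archToAdelic_eq_adelicTensorEnd`) — step (6);
* §1 **`cmPairRep_conjPlaneTorus_conjLineTensorFin_of_arch_eigen`** — given (STRIP) `X' = E(Y ⊗ F)` (step (1): the archimedean factor `Y` of the
  conjugated tensor), an eigen-identity of `ω_∞(1, archConjDiag (t₀,t₁))` on `Y` IS #1213's hypothesis `h'`;
* §2 **`cmArchWeilRep_archConjDiag_eigen_of_transport`** — the TRANSPORT ALGEBRA: if `archConjDiag u = k · archDiag (ρ u) · k⁻¹` in `U(diag dW)(L ⊗ ℝ)`
  for one archimedean `k` and a re-labelling `ρ` of the archimedean torus (step (7): `k⁻¹ (g₀ d(t) g₀⁻¹) k = d(t ∘ σ⁻¹)` place by place), and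
  (VT) `Y = a • ω_∞(1, k) Φ_X` (steps (2)–(5): vacuum transport), then the plane eigen-identity `ω_∞(1, archDiag u) Φ_X = χ(u) • Φ_X` ((BT)) gives
  `ω_∞(1, archConjDiag u) Y = χ(ρ u) • Y` — one line of group algebra in the honest representation `cmArchWeilRep` (`rep_conj_apply_eq_smul`);
* §3 **`slotTypeVec_sub_eq_of_conj_transport`** — family level: with `χ (t₀,t₁) = archWeight m₀ t₀ · archWeight m₁ t₁` on the plane box (#1214 §5's
  hypothesis, discharged by (TT)) and `χ (ρ (t₀,t₁)) = archWeight n₂ t₀ · archWeight n₃ t₁` (the re-labelled tables), **`slotTypeVec 2 − slotTypeVec 0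
  = n₂ − m₀` and `slotTypeVec 3 − slotTypeVec 0 = n₃ − m₀`** — i.e. `hΔ₂`/`hΔ₃` in closed form once (STRIP), (7) and (VT) are supplied
  (expected tables, theta-3 memo §2: `n₂(w) = m_{σ_w 0}(w)`, `n₃(w) = m_{σ_w 1}(w)` with `σ_w` the sign-matching of the lines `⟨dW' j⟩`, `⟨dW i⟩` at `w`,
  so `Δ₂, Δ₃ ∈ {0, ± slotDelta}`).
Nothing here is a claim of PerL/QW8; kernel algebra over the tree's constructed objects.  What is NOT here (named, with owners per the memo):
(STRIP) tensor stripping of `ω(r_F h₀)` at a pure tensor (W2-⊗ files `AdelicMetaplecticTensorStripping` + `…FiniteImplementer`); (7) the sign-matching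
`k`, `ρ` with `archConjDiag u = k · archDiag (ρ u) · k⁻¹` (2×2 linear algebra over `L ⊗ ℝ`); (VT) `Y = a • ω_∞(1,k) Φ_X` (archimedean implementer
uniqueness, `ArchVacuumSection.eq_relCoeff_smul_of_liftsTo`).
-/

set_option autoImplicit false

noncomputable section

open scoped Matrix Classical SchwartzMap TensorProduct
open NumberField.mixedEmbedding (mixedSpace)
open Literature.NumberTheory.Automorphic Literature.NumberTheory.Automorphic.UnitaryGroup Literature.NumberTheory.Weil1964
open Literature.NumberTheory.GelbartRogawski1991 Literature.NumberTheory.GelbartRogawski1991.UnitaryDualPair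
open HodgeCM.Adelic HodgeCM.PerL34 HodgeCM.PerL34.TorusEmbedding

namespace HodgeCM.Model.ArchSideTerm

/-! ## § 0 (ARCH): the conjugated torus at archimedean norm-one ideles is binder-2's archimedean element `archConjDiag` -/

section ConjPlane

variable {L : CMField} {ι₁ : L →+* ℂ} (V : HermSpace3 L ι₁) (S : StubTree.SeesawDatum L)
variable
  (hGR : (cmSplittingDatum (L : Type) finProdFinEquiv (frameD V) (frameD_real V) (frameD_ne V) (dW S) (dW_real S) (dW_ne S)).CompatibleSplitting)

/-- the two `toAdeleGL`s of the package (vendored `Literature.NumberTheory.Automorphic.toAdeleGL`, PKG `HodgeCM.Adelic.toAdeleGL`) agree. -/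
theorem toAdeleGL_eq_adelic_toAdeleGL {n : Type} [Fintype n] [DecidableEq n] (g : GL n (L : Type)) :
    Literature.NumberTheory.Automorphic.toAdeleGL (L : Type) g = HodgeCM.Adelic.toAdeleGL (L : Type) g :=
  Units.ext (by rw [Literature.NumberTheory.Automorphic.val_toAdeleGL, HodgeCM.Adelic.val_toAdeleGL])

/-- **`diag(t₀,t₁)_𝔸 = archToAdelic (archDiag (dW' S) (t₀,t₁))`** for the PRIMED plane vector (twin of #1214 `cmPlaneTorusIdeles_inf_eq_archToAdelic`). -/
theorem cmPlaneTorusIdeles_inf_eq_archToAdelic' (t₀ t₁ : ↥(relNormOneInfUnits (↥(NumberField.maximalRealSubfield (L : Type))) (L : Type))) :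
    cmPlaneTorusIdeles (L : Type) (dW' S)
        (relNormOneInfToIdeles (↥(NumberField.maximalRealSubfield (L : Type))) (L : Type) t₀,
          relNormOneInfToIdeles (↥(NumberField.maximalRealSubfield (L : Type))) (L : Type) t₁) =
      archToAdelic (↥(NumberField.maximalRealSubfield (L : Type))) (L : Type) (NumberField.IsCMField.complexConj (L : Type)) 2 (Matrix.diagonal (dW' S))
        (HypCensus.archDiag (L : Type) (dW' S) (NumberField.SeesawArchTorus.mk (L : Type) t₀ t₁)) := by
  rw [← HypCensus.cmAdelicEquiv_jT_toAdeles]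
  refine (cmAdelicEquiv_eq_cmPlaneTorusIdeles (L : Type) (dW' S) _ _ _ ?_).symm
  rw [coe_jT, val_toGL]
  rfl

/-- **(ARCH): the CONJUGATED plane torus at archimedean norm-one ideles IS the archimedean element `g₀,∞ · diag(t₀,t₁) · g₀,∞⁻¹`** of
`U(diag dW)(L ⊗ ℝ)` — binder-2's `HypCensus.archConjDiag` (`TorusChart` §2: `toAdeleGL_mul_toGL_mul_inv`, `ofInfinite_archDiagGL`). -/
theorem cmConjPlaneTorusIdeles_inf_eq_archToAdelic (t₀ t₁ : ↥(relNormOneInfUnits (↥(NumberField.maximalRealSubfield (L : Type))) (L : Type))) :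
    cmConjPlaneTorusIdeles (L : Type) (dW S) (dW' S) S.isoGL (isoGL_hg₀ S)
        (relNormOneInfToIdeles (↥(NumberField.maximalRealSubfield (L : Type))) (L : Type) t₀,
          relNormOneInfToIdeles (↥(NumberField.maximalRealSubfield (L : Type))) (L : Type) t₁) =
      archToAdelic (↥(NumberField.maximalRealSubfield (L : Type))) (L : Type) (NumberField.IsCMField.complexConj (L : Type)) 2 (Matrix.diagonal (dW S))
        (HypCensus.archConjDiag (L : Type) S.isoGL (dW S) (dW' S) (isoGL_hg₀ S) (NumberField.SeesawArchTorus.mk (L : Type) t₀ t₁)) := by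
  apply Subtype.ext
  rw [coe_cmConjPlaneTorusIdeles, cmPlaneTorusIdeles_inf_eq_archToAdelic' S t₀ t₁, toAdeleGL_eq_adelic_toAdeleGL]
  change HodgeCM.Adelic.toAdeleGL (L : Type) S.isoGL *
      GLn.ofInfinite 2 (L : Type) (HypCensus.archDiagGL (L : Type) (NumberField.SeesawArchTorus.mk (L : Type) t₀ t₁)) *
        (HodgeCM.Adelic.toAdeleGL (L : Type) S.isoGL)⁻¹ =
    GLn.ofInfinite 2 (L : Type) (HypCensus.archGL (L : Type) S.isoGL * HypCensus.archDiagGL (L : Type) (NumberField.SeesawArchTorus.mk (L : Type) t₀ t₁) *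
      (HypCensus.archGL (L : Type) S.isoGL)⁻¹)
  rw [HypCensus.ofInfinite_archDiagGL, HypCensus.toAdeleGL_mul_toGL_mul_inv]

/-- **step (6): `ω(1, g₀·diag(t₀,t₁)·g₀⁻¹) = ω_∞(1, archConjDiag (t₀,t₁)) ⊗ 1`** on `𝒮(𝔸^6)` — the big pair's conjugated torus acts through
binder-2's archimedean factor (carch-1 `cmPairRep_archToAdelic_eq_adelicTensorEnd`). -/
theorem cmPairRep_conjPlaneTorus_eq_adelicTensorEnd (t₀ t₁ : ↥(relNormOneInfUnits (↥(NumberField.maximalRealSubfield (L : Type))) (L : Type))) :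
    cmPairRep (L : Type) finProdFinEquiv (frameD V) (frameD_real V) (frameD_ne V) (dW S) (dW_real S) (dW_ne S) hGR
        (1, cmConjPlaneTorusIdeles (L : Type) (dW S) (dW' S) S.isoGL (isoGL_hg₀ S)
          (relNormOneInfToIdeles (↥(NumberField.maximalRealSubfield (L : Type))) (L : Type) t₀,
            relNormOneInfToIdeles (↥(NumberField.maximalRealSubfield (L : Type))) (L : Type) t₁)) =
      adelicTensorEnd
        (HypCensus.cmArchWeilRep (L : Type) finProdFinEquiv (frameD V) (frameD_real V) (frameD_ne V) (dW S) (dW_real S) (dW_ne S) hGR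
            (1, HypCensus.archConjDiag (L : Type) S.isoGL (dW S) (dW' S) (isoGL_hg₀ S) (NumberField.SeesawArchTorus.mk (L : Type) t₀ t₁)) :
          𝓢((Fin (3 * 2) → mixedSpace (↥(NumberField.maximalRealSubfield (L : Type)))), ℂ) →ₗ[ℂ] _)
        LinearMap.id := by
  rw [cmConjPlaneTorusIdeles_inf_eq_archToAdelic, ← cmPairRep_archToAdelic_eq_adelicTensorEnd, map_one]
  rfl

/-! ## § 1 (STRIP) + (6): an archimedean eigen-identity on the archimedean factor of the conjugated tensor IS #1213's `h'` -/

/-- **(STRIP) + (6) ⇒ `h'`**: if the conjugated see-saw tensor `X'` of two test functions is the pure tensor `E(Y ⊗ F)` and binder-2's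
`ω_∞(1, archConjDiag (t₀,t₁))` acts on `Y` by the scalar `κ t₀ t₁`, then the ADELIC big pair acts on `X'` by the same scalar
(any scalar family `κ`, any test functions). -/
theorem cmPairRep_conjPlaneTorus_conjLineTensorFin_of_arch_eigen
    (φ₂ φ₃ : piSchwartzBruhat (↥(NumberField.maximalRealSubfield (L : Type))) (Fin 3))
    (Y : 𝓢((Fin (3 * 2) → mixedSpace (↥(NumberField.maximalRealSubfield (L : Type)))), ℂ))
    (F : FinSB (↥(NumberField.maximalRealSubfield (L : Type))) (Fin (3 * 2)))
    (hstrip : cmConjLineTensorFin (L : Type) finProdFinEquiv e₁ (frameD V) (frameD_real V) (frameD_ne V) (dW S) (dW_real S) (dW_ne S)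
        (dW' S) (dW'_real S) (dW'_ne S) S.isoGL (isoGL_hg₀ S) φ₂ φ₃ =
      piSchwartzBruhatEquiv (↥(NumberField.maximalRealSubfield (L : Type))) (Fin (3 * 2)) (Y ⊗ₜ F))
    (κ : ↥(relNormOneInfUnits (↥(NumberField.maximalRealSubfield (L : Type))) (L : Type)) →
      ↥(relNormOneInfUnits (↥(NumberField.maximalRealSubfield (L : Type))) (L : Type)) → ℂ)
    (harch' : ∀ t₀ t₁ : ↥(relNormOneInfUnits (↥(NumberField.maximalRealSubfield (L : Type))) (L : Type)),
      HypCensus.cmArchWeilRep (L : Type) finProdFinEquiv (frameD V) (frameD_real V) (frameD_ne V) (dW S) (dW_real S) (dW_ne S) hGR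
          (1, HypCensus.archConjDiag (L : Type) S.isoGL (dW S) (dW' S) (isoGL_hg₀ S) (NumberField.SeesawArchTorus.mk (L : Type) t₀ t₁)) Y =
        κ t₀ t₁ • Y)
    (t₀ t₁ : ↥(relNormOneInfUnits (↥(NumberField.maximalRealSubfield (L : Type))) (L : Type))) :
    cmPairRep (L : Type) finProdFinEquiv (frameD V) (frameD_real V) (frameD_ne V) (dW S) (dW_real S) (dW_ne S) hGR
        (1, cmConjPlaneTorusIdeles (L : Type) (dW S) (dW' S) S.isoGL (isoGL_hg₀ S)
          (relNormOneInfToIdeles (↥(NumberField.maximalRealSubfield (L : Type))) (L : Type) t₀,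
            relNormOneInfToIdeles (↥(NumberField.maximalRealSubfield (L : Type))) (L : Type) t₁))
      (cmConjLineTensorFin (L : Type) finProdFinEquiv e₁ (frameD V) (frameD_real V) (frameD_ne V) (dW S) (dW_real S) (dW_ne S)
        (dW' S) (dW'_real S) (dW'_ne S) S.isoGL (isoGL_hg₀ S) φ₂ φ₃) =
      κ t₀ t₁ •
    cmConjLineTensorFin (L : Type) finProdFinEquiv e₁ (frameD V) (frameD_real V) (frameD_ne V) (dW S) (dW_real S) (dW_ne S)
        (dW' S) (dW'_real S) (dW'_ne S) S.isoGL (isoGL_hg₀ S) φ₂ φ₃ := by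
  rw [hstrip, cmPairRep_conjPlaneTorus_eq_adelicTensorEnd V S hGR, adelicTensorEnd_apply_tmul, LinearMap.id_apply]
  erw [harch' t₀ t₁]
  rw [← TensorProduct.smul_tmul', map_smul]

/-! ## § 2 the transport algebra in the honest archimedean representation -/

/-- group algebra in any representation: if `Y = a • ω k Φ` and `ω d Φ = c • Φ` then `ω (k d k⁻¹) Y = c • Y`. -/
theorem rep_conj_apply_eq_smul {G M : Type*} [Group G] [AddCommGroup M] [Module ℂ M] (ω : Representation ℂ G M)
    (k d : G) (Φ Y : M) (a c : ℂ) (hY : Y = a • ω k Φ) (hd : ω d Φ = c • Φ) :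
    ω (k * d * k⁻¹) Y = c • Y := by
  rw [hY, map_smul, map_mul, map_mul, Module.End.mul_apply, Module.End.mul_apply, ← Module.End.mul_apply (ω k⁻¹) (ω k) Φ,
    ← map_mul, inv_mul_cancel, map_one, Module.End.one_apply, hd, map_smul, smul_comm]

/-- **(7) + (VT) + the plane eigen-identity ⇒ the conjugated eigen-identity.**  If `archConjDiag u = k · archDiag (dW S) (ρ u) · k⁻¹`
in `U(diag dW)(L ⊗ ℝ)`, `Y = a • ω_∞(1, k) Φ_X` and `ω_∞(1, archDiag (dW S) u) Φ_X = χ u • Φ_X` for all `u`, then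
`ω_∞(1, archConjDiag u) Y = χ (ρ u) • Y` — `ω_∞ = cmArchWeilRep … hGR` is a representation. -/
theorem cmArchWeilRep_archConjDiag_eigen_of_transport
    (ΦX Y : 𝓢((Fin (3 * 2) → mixedSpace (↥(NumberField.maximalRealSubfield (L : Type)))), ℂ))
    (k : ↥(UnitaryGroup.arch (↥(NumberField.maximalRealSubfield (L : Type))) (L : Type) (NumberField.IsCMField.complexConj (L : Type)) 2
      (Matrix.diagonal (dW S))))
    (a : ℂ)
    (hY : Y = a • HypCensus.cmArchWeilRep (L : Type) finProdFinEquiv (frameD V) (frameD_real V) (frameD_ne V) (dW S) (dW_real S) (dW_ne S) hGR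
      (1, k) ΦX)
    (ρ : NumberField.SeesawArchTorus (L : Type) → NumberField.SeesawArchTorus (L : Type))
    (hk : ∀ u, HypCensus.archConjDiag (L : Type) S.isoGL (dW S) (dW' S) (isoGL_hg₀ S) u = k * HypCensus.archDiag (L : Type) (dW S) (ρ u) * k⁻¹)
    (χ : NumberField.SeesawArchTorus (L : Type) → ℂ)
    (harch : ∀ u, HypCensus.cmArchWeilRep (L : Type) finProdFinEquiv (frameD V) (frameD_real V) (frameD_ne V) (dW S) (dW_real S) (dW_ne S) hGR
      (1, HypCensus.archDiag (L : Type) (dW S) u) ΦX = χ u • ΦX)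
    (u : NumberField.SeesawArchTorus (L : Type)) :
    HypCensus.cmArchWeilRep (L : Type) finProdFinEquiv (frameD V) (frameD_real V) (frameD_ne V) (dW S) (dW_real S) (dW_ne S) hGR
        (1, HypCensus.archConjDiag (L : Type) S.isoGL (dW S) (dW' S) (isoGL_hg₀ S) u) Y =
      χ (ρ u) • Y := by
  have hprod : ((1 : ↥(UnitaryGroup.arch (↥(NumberField.maximalRealSubfield (L : Type))) (L : Type) (NumberField.IsCMField.complexConj (L : Type)) 3
        (Matrix.diagonal (frameD V)))), HypCensus.archConjDiag (L : Type) S.isoGL (dW S) (dW' S) (isoGL_hg₀ S) u) =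
      ((1, k) * (1, HypCensus.archDiag (L : Type) (dW S) (ρ u))) * (1, k)⁻¹ :=
    Prod.ext (by simp) (hk u)
  rw [hprod]
  exact rep_conj_apply_eq_smul _ (1, k) (1, HypCensus.archDiag (L : Type) (dW S) (ρ u)) ΦX Y a (χ (ρ u)) hY (harch (ρ u))

end ConjPlane

/-! ## § 3 family level: `slotTypeVec 2 − slotTypeVec 0`, `slotTypeVec 3 − slotTypeVec 0` from the transport datum -/

section Vec

variable {L : CMField} {ι₁ : L →+* ℂ} (V : HermSpace3 L ι₁) (c : SeesawCtx L)
variable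
  (hGR : (cmSplittingDatum (L : Type) finProdFinEquiv (frameD V) (frameD_real V) (frameD_ne V) (dW c.D) (dW_real c.D) (dW_ne c.D)).CompatibleSplitting)
  (hGR₀ : (cmSplittingDatum (L : Type) (e₁) (frameD V) (frameD_real V) (frameD_ne V) (lineVec (L : Type) (dW c.D 0))
    (fun _ => dW_real c.D 0) (fun _ => dW_ne c.D 0)).CompatibleSplitting)
  (hGR₁ : (cmSplittingDatum (L : Type) (e₁) (frameD V) (frameD_real V) (frameD_ne V) (lineVec (L : Type) (dW c.D 1))
    (fun _ => dW_real c.D 1) (fun _ => dW_ne c.D 1)).CompatibleSplitting)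
  (hGR₂ : (cmSplittingDatum (L : Type) (e₁) (frameD V) (frameD_real V) (frameD_ne V) (lineVec (L : Type) (dW' c.D 0))
    (fun _ => dW'_real c.D 0) (fun _ => dW'_ne c.D 0)).CompatibleSplitting)
  (hGR₃ : (cmSplittingDatum (L : Type) (e₁) (frameD V) (frameD_real V) (frameD_ne V) (lineVec (L : Type) (dW' c.D 1))
    (fun _ => dW'_real c.D 1) (fun _ => dW'_ne c.D 1)).CompatibleSplitting)
  (h₁W : (∀ j, 0 < (ι₁ (dW c.D j)).re) ∨ ∀ j, (ι₁ (dW c.D j)).re < 0)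
  (hpos₀ : 0 < HypCensus.cmXW (L : Type) (frameD V) (lineVec (L : Type) (dW c.D 0)) (fun _ => dW_real c.D 0) ι₁ (HypCensus.cmPlace (L : Type) ι₁) 0)
  (hpos₁ : 0 < HypCensus.cmXW (L : Type) (frameD V) (lineVec (L : Type) (dW c.D 1)) (fun _ => dW_real c.D 1) ι₁ (HypCensus.cmPlace (L : Type) ι₁) 0)
  (hpos₂ : 0 < HypCensus.cmXW (L : Type) (frameD V) (lineVec (L : Type) (dW' c.D 0)) (fun _ => dW'_real c.D 0) ι₁ (HypCensus.cmPlace (L : Type) ι₁) 0)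
  (hpos₃ : 0 < HypCensus.cmXW (L : Type) (frameD V) (lineVec (L : Type) (dW' c.D 1)) (fun _ => dW'_real c.D 1) ι₁ (HypCensus.cmPlace (L : Type) ι₁) 0)

/-- **`hΔ₂` / `hΔ₃` FROM A VACUUM-TRANSPORT DATUM.**  Inputs: (STRIP) the archimedean factor `Y` of the conjugated see-saw tensor of (F1)'s primed
line test functions (level 1); (7) an archimedean `k ∈ U(diag dW)(L ⊗ ℝ)` and a re-labelling `ρ` of the archimedean torus with
`archConjDiag u = k · archDiag (ρ u) · k⁻¹` in `U(diag dW)(L ⊗ ℝ)`; (VT) `Y = c • ω_∞(1,k) Φ_X` on the plane box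
`Φ_X = ctxSlotArchBox` of #1214; the plane eigen-character `χ` of `Φ_X` ((BT): `ω_∞(1, archDiag u) Φ_X = χ u • Φ_X`) with tables `(m₀, m₁)` and its
`ρ`-relabelled tables `(n₂, n₃)`.  Output: `slotTypeVec 2 − slotTypeVec 0 = n₂ − m₀`, `slotTypeVec 3 − slotTypeVec 0 = n₃ − m₀`. -/
theorem slotTypeVec_sub_eq_of_conj_transport
    (Y : 𝓢((Fin (3 * 2) → mixedSpace (↥(NumberField.maximalRealSubfield (L : Type)))), ℂ))
    (F : FinSB (↥(NumberField.maximalRealSubfield (L : Type))) (Fin (3 * 2)))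
    (hstrip : cmConjLineTensorFin (L : Type) finProdFinEquiv e₁ (frameD V) (frameD_real V) (frameD_ne V) (dW c.D) (dW_real c.D) (dW_ne c.D)
        (dW' c.D) (dW'_real c.D) (dW'_ne c.D) c.D.isoGL (isoGL_hg₀ c.D)
        (SupplyInstance.testFun (↥(NumberField.maximalRealSubfield (L : Type))) (Fin 3)
          (linePhi V (dW' c.D 0) (dW'_real c.D 0) (dW'_ne c.D 0) hpos₂) (lineX₀ V (dW' c.D 0) (dW'_real c.D 0) (dW'_ne c.D 0) hpos₂) 1)
        (SupplyInstance.testFun (↥(NumberField.maximalRealSubfield (L : Type))) (Fin 3)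
          (linePhi V (dW' c.D 1) (dW'_real c.D 1) (dW'_ne c.D 1) hpos₃) (lineX₀ V (dW' c.D 1) (dW'_real c.D 1) (dW'_ne c.D 1) hpos₃) 1) =
      piSchwartzBruhatEquiv (↥(NumberField.maximalRealSubfield (L : Type))) (Fin (3 * 2)) (Y ⊗ₜ F))
    (k : ↥(UnitaryGroup.arch (↥(NumberField.maximalRealSubfield (L : Type))) (L : Type) (NumberField.IsCMField.complexConj (L : Type)) 2
      (Matrix.diagonal (dW c.D))))
    (ρ : NumberField.SeesawArchTorus (L : Type) → NumberField.SeesawArchTorus (L : Type))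
    (hk : ∀ u, HypCensus.archConjDiag (L : Type) c.D.isoGL (dW c.D) (dW' c.D) (isoGL_hg₀ c.D) u =
      k * HypCensus.archDiag (L : Type) (dW c.D) (ρ u) * k⁻¹)
    (a : ℂ)
    (hY : Y = a • HypCensus.cmArchWeilRep (L : Type) finProdFinEquiv (frameD V) (frameD_real V) (frameD_ne V) (dW c.D) (dW_real c.D) (dW_ne c.D) hGR
      (1, k) (ctxSlotArchBox V c hpos₀ hpos₁))
    (χ : NumberField.SeesawArchTorus (L : Type) → ℂ)
    (harch : ∀ u, HypCensus.cmArchWeilRep (L : Type) finProdFinEquiv (frameD V) (frameD_real V) (frameD_ne V) (dW c.D) (dW_real c.D) (dW_ne c.D) hGR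
      (1, HypCensus.archDiag (L : Type) (dW c.D) u) (ctxSlotArchBox V c hpos₀ hpos₁) = χ u • ctxSlotArchBox V c hpos₀ hpos₁)
    (m₀ m₁ n₂ n₃ : NumberField.InfinitePlace (L : Type) → ℤ)
    (hχ : ∀ t₀ t₁ : ↥(relNormOneInfUnits (↥(NumberField.maximalRealSubfield (L : Type))) (L : Type)),
      χ (NumberField.SeesawArchTorus.mk (L : Type) t₀ t₁) = archWeight (L : Type) m₀ t₀ * archWeight (L : Type) m₁ t₁)
    (hχρ : ∀ t₀ t₁ : ↥(relNormOneInfUnits (↥(NumberField.maximalRealSubfield (L : Type))) (L : Type)),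
      χ (ρ (NumberField.SeesawArchTorus.mk (L : Type) t₀ t₁)) = archWeight (L : Type) n₂ t₀ * archWeight (L : Type) n₃ t₁) :
    slotTypeVec V c hGR hGR₀ hGR₁ hGR₂ hGR₃ h₁W 2 - slotTypeVec V c hGR hGR₀ hGR₁ hGR₂ hGR₃ h₁W 0 = n₂ - m₀ ∧
      slotTypeVec V c hGR hGR₀ hGR₁ hGR₂ hGR₃ h₁W 3 - slotTypeVec V c hGR hGR₀ hGR₁ hGR₂ hGR₃ h₁W 0 = n₃ - m₀ :=
  slotTypeVec_sub_eq_of_conjPlaneTorus_eigen V c hGR hGR₀ hGR₁ hGR₂ hGR₃ h₁W hpos₀ hpos₁ hpos₂ hpos₃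
    one_ne_zero one_ne_zero one_ne_zero one_ne_zero m₀ m₁ n₂ n₃
    (fun t₀ t₁ => by
      rw [← hχ t₀ t₁]
      exact cmPairRep_planeTorus_lineTensorFin_of_arch_eigen V c.D hGR
        (linePhi V (dW c.D 0) (dW_real c.D 0) (dW_ne c.D 0) hpos₀) (linePhi V (dW c.D 1) (dW_real c.D 1) (dW_ne c.D 1) hpos₁)
        (lineX₀ V (dW c.D 0) (dW_real c.D 0) (dW_ne c.D 0) hpos₀) (lineX₀ V (dW c.D 1) (dW_real c.D 1) (dW_ne c.D 1) hpos₁) 1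
        (fun t₀ t₁ => χ (NumberField.SeesawArchTorus.mk (L : Type) t₀ t₁)) (fun t₀ t₁ => harch _) t₀ t₁)
    (fun t₀ t₁ => by
      rw [← hχρ t₀ t₁]
      exact cmPairRep_conjPlaneTorus_conjLineTensorFin_of_arch_eigen V c.D hGR _ _ Y F hstrip
        (fun t₀ t₁ => χ (ρ (NumberField.SeesawArchTorus.mk (L : Type) t₀ t₁)))
        (fun t₀ t₁ => cmArchWeilRep_archConjDiag_eigen_of_transport V c.D hGR (ctxSlotArchBox V c hpos₀ hpos₁) Y k a hY ρ hk χ harch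
          (NumberField.SeesawArchTorus.mk (L : Type) t₀ t₁)) t₀ t₁)

end Vec

end HodgeCM.Model.ArchSideTerm

end
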